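import Summits.BirchSwinnertonDyer.BirchSwinnertonDyer.Theorems.GenusKolyvaginAtTwoGenusPrimitiveSupplyAtTwoShaPlaneDoorTwin
import Summits.BirchSwinnertonDyer.BirchSwinnertonDyer.Theorems.ByReductionTypeAtTwoRankOneAtTwoBigImageOddLocalOneDoorTranspositionParity
import Summits.BirchSwinnertonDyer.Rank1Residual.F1Sign2.HeegnerOddDoorFieldAtTwo
import Summits.BirchSwinnertonDyer.Rank1Residual.F1Sign2.GenusPacketAtTwoProofs
import Literature.NumberTheory.EllipticCurves.ShaPrimaryIsogenyKill
import Literature.NumberTheory.EllipticCurves.LeadingTermProofs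
import HarnessLib

/-!
# Route `GenusKolyvaginAtTwo`, crux #2 `GenusPrimitiveSupplyAtTwo` (stmt-BirchSwinnertonDyer-22136):
# DESC-29-K ⟺ DESC-29-Q IN THE KERNEL — the `M₀ = 0` Heegner door in K-currency and in ℚ-pair currency are ONE statement

Width seat `bsd-line-gk2-p5` g18 (cell `bsd-f1-sign2`, SUPPLY lineage of crux 22136), file 55 of the series; sequel of files 50–54. THEOREMS ONLY
(no definition, no named fact, no `sorry`); helper `--supports stmt-BirchSwinnertonDyer-22136`; no item is closed; BSD is not proved by any of this.

WHAT. -desc's DESC-29-K `F1Sign2.HeegnerOddDoorFieldSelmerAtTwo` (= the `M₀ = 0` rung of the route's U⁺_T stmt-23378 ∧ its exactness, on descent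
doors, in K-currency: `#Sel₂(E/K) = 2 ∧ Ш(E/K)[2^∞] = 0`) and DESC-29-Q `F1Sign2.HeegnerOddDoorPairAtTwo` (the ℚ-pair:
`#Sel₂(W)·#Sel₂(W^{(d_K)}) = 2 ∧ Ш(W)[2] = 0 ∧ Ш(W^{(d_K)})[2] = 0`) have the SAME hypotheses (`ρ̄_{E,2}` onto, `∏c_v` odd, `K` a door field,
`P ∈ E(K)` a Heegner point with `P ∉ 2E(K) + tors`); both are THEOREM-CANDIDATES beyond print (REF2 v47 §9; the content is Kolyvagin mod `2`
at `Δ > 0`, -es R18-U₀⁺). This file proves the two glues, UNCONDITIONALLY, so that ONE proof closes both rows: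

* §224 `heegnerOddDoorFieldSelmerAtTwo_of_heegnerOddDoorPairAtTwo : HeegnerOddDoorPairAtTwo → HeegnerOddDoorFieldSelmerAtTwo` (Q ⟹ K):
  `(#Sel₂ W, #Sel₂ W^{(d)}) = (2, 1)`: rank `W = 1`, DESC-28-G BY NAME (file 50) gives `#Sel₂(W_K) = 2`, the descent count over `K` (`rank W(K) = 1`,
  `W(K)[2] = 0`) gives `Ш(W_K)[2] = 0`, hence `Ш(W_K)[2^∞] = 0`; `(1, 2)`: `Sel₂(W) = Sel₂^{str ∞}(W)` of order `1`, so `#Sel₂^{rel ∞}(W) = 2` and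
  file 53's COUNT SKELETON gives `#Sel₂(W_K) = 2·r`, `r ≤ 1`; then `rank W(K) = 0 + 1` as before.
* §225 `heegnerOddDoorPairAtTwo_of_heegnerOddDoorFieldSelmerAtTwo : HeegnerOddDoorFieldSelmerAtTwo → HeegnerOddDoorPairAtTwo` (K ⟹ Q):
  `2 = #Sel₂(W_K) = #Sel₂^{rel ∞}(W)·r` forces `#Sel₂^{rel ∞}(W) = 2`, `#Sel₂^{str ∞}(W) = 1`; THEOREM A's decided dichotomy makes
  `{#Sel₂ W, #Sel₂ W^{(d)}} = {2, 1}` (product `2`); `P ∉ 2E(K) + tors` is non-torsion, so `rank W(K) = 1 = rank W + rank W^{(d)}`, which pins the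
  rank-`1` twin to the `2`-Selmer group of order `2` and kills both `Ш[2]`.

Honest framing: bookkeeping over files 47–54 and the tree's descent counts; kernel-new glue; beyond-print theorem: no (rows K and Q themselves stay
OPEN — their common content is the reciprocity step (K5) of MEMO-desc §29.2 / -es §18.11). Crux 22136 stays OPEN exactly at (U) 24947 ∧ (CONV₂)
19220/24948. BSD is not proved by any of this.

References: [Kramer1981] Thm. 1, Prop. 6, Prop. 7; [MazurRubin2010] Lemma 3.2, Prop. 3.3; [GrossLMS1991] Props. 5.4, 6.2; [SilvermanAEC2009] Thm X.4.2.
-/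

set_option linter.dupNamespace false -- tree convention: `Summit.BirchSwinnertonDyer.BirchSwinnertonDyer.Theorems` (summit = sub-problem)
set_option autoImplicit false

noncomputable section

open scoped Classical AddSubgroup

namespace Summit.BirchSwinnertonDyer.BirchSwinnertonDyer.Theorems.GenusKolyArch

open WeierstrassCurve NumberField Field
open Literature.NumberTheory.EllipticCurves Literature.NumberTheory.GaloisRepresentations
open Summit.BirchSwinnertonDyer.Rank1Residual.X11b.KummerPT (kummerStrict)
open Summit.BirchSwinnertonDyer.Rank1Residual.F1Sign2 (selmerGroupRelaxedAtInfinityAtTwo DescAdmissible NoRationalTwoTorsion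
  selmerTwoCard twistSelmerTwoCard shaTwoCard IsDoorField fieldSelmerTwoCard fieldShaTwoPrimaryCard doorTwist NotTwiceUpToTorsion
  HeegnerOddDoorFieldSelmerAtTwo HeegnerOddDoorPairAtTwo)

/-! ## §224 Descent counts and small arithmetic -/

section Counts

variable (W : WeierstrassCurve ℚ) [W.IsElliptic] [W.IsGloballyMinimal]

omit [W.IsGloballyMinimal] in
/-- Descent count over `ℚ` with `E(ℚ)[2] = 0`: `#Sel₂(W) = 2^{rank W} · #Ш(W)[2]`. [cite: SilvermanAEC2009, Thm X.4.2(a)] -/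
theorem selmerTwoCard_eq_two_pow_mul_shaTwoCard (hT : NoRationalTwoTorsion W) :
    selmerTwoCard W = 2 ^ W.mordellWeilRank * shaTwoCard W := by
  have hinst : (instDecidableEqRat : DecidableEq ℚ) = fun a b => Classical.propDecidable (a = b) := Subsingleton.elim _ _
  have ht : Nat.card (AddSubgroup.torsionBy W.toAffine.Point ((2 : ℕ) : ℤ)) = 1 := by
    have hbot : AddSubgroup.torsionBy W.toAffine.Point ((2 : ℕ) : ℤ) = ⊥ :=
      (AddSubgroup.eq_bot_iff_forall _).mpr fun P hP ↦
        Summit.BirchSwinnertonDyer.Rank1Residual.F1Sign2.EggDoubling.eq_zero_of_two_smul_eq_zero W hT P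
          (AddSubgroup.torsionBy.nsmul_iff.mp hP)
    rw [hbot, AddSubgroup.card_bot]
  rw [hinst] at ht
  have h := card_selmerGroup_eq_pow_rank_mul W 2
  rw [ht, mul_one, Nat.cast_ofNat] at h
  exact h

omit [W.IsGloballyMinimal] in
/-- Descent count for the twist: `#Sel₂(W^{(d)}) = 2^{rank W^{(d)}} · #Ш(W^{(d)})[2]` (`E(ℚ)[2] = 0`, `d ≠ 0`). [cite: SilvermanAEC2009, Thm X.4.2(a)] -/
theorem twistSelmerTwoCard_eq_two_pow_mul_shaTwoCard (hT : NoRationalTwoTorsion W) {d : ℤ} (hd0 : d ≠ 0) :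
    twistSelmerTwoCard W d = 2 ^ (W.quadraticTwist (d : ℚ)).mordellWeilRank * shaTwoCard (W.quadraticTwist (d : ℚ)) := by
  have hd0' : ((d : ℤ) : ℚ) ≠ 0 := Int.cast_ne_zero.mpr hd0
  haveI : (W.quadraticTwist (d : ℚ)).IsElliptic := W.isElliptic_quadraticTwist hd0'
  exact selmerTwoCard_eq_two_pow_mul_shaTwoCard (W.quadraticTwist (d : ℚ)) (noRationalTwoTorsion_quadraticTwist W hT hd0')

/-- `2^r · s = 1` forces `r = 0` and `s = 1`. [folklore] -/
theorem eq_of_two_pow_mul_eq_one {r s : ℕ} (h : 2 ^ r * s = 1) : r = 0 ∧ s = 1 :=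
  ⟨Nat.pow_right_injective le_rfl ((Nat.eq_one_of_mul_eq_one_right h).trans (pow_zero 2).symm),
    Nat.eq_one_of_mul_eq_one_left h⟩

variable (K : Type) [Field K] [NumberField K]

omit [W.IsElliptic] [W.IsGloballyMinimal] in
/-- **`Ш(W_K/K)[2] = 0 ⟹ #Ш(W_K/K)[2^∞] = 1`** (a group without `2`-torsion has trivial `2`-primary part). [cite: Fuchs1970, Ch. I §1] -/
theorem fieldShaTwoPrimaryCard_eq_one_of_natCard_sha_two_eq_one
    (h : Nat.card ((W.baseChange K).sha ⊓ AddSubgroup.torsionBy (W.baseChange K).galH1 ((2 : ℕ) : ℕ) : AddSubgroup _) = 1) :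
    fieldShaTwoPrimaryCard W K = 1 := by
  rw [natCard_sha_inf_torsionBy_two_eq_natCard_sha_torsionBy_two W K, AddSubgroup.card_eq_one] at h
  have hbot := primaryComponent_eq_bot_of_torsionBy_eq_bot (X := ↥(W.baseChange K).sha) 2 (by exact_mod_cast h)
  change Nat.card (AddCommGroup.primaryComponent (↥(W.baseChange K).sha) 2) = 1
  rw [hbot, AddSubgroup.card_bot]

omit [W.IsGloballyMinimal] in
/-- `P ∉ 2E(K) + tors` ⟹ `P` has infinite order ⟹ `rank E(K) ≥ 1`. [cite: SilvermanAEC2009, VIII.6] -/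
theorem one_le_mordellWeilRank_baseChange_of_notTwiceUpToTorsion {P : (W.baseChange K).toAffine.Point}
    (hnt : NotTwiceUpToTorsion W K P) : 1 ≤ (W.baseChange K).mordellWeilRank := by
  haveI : (W.baseChange K).IsElliptic := inferInstanceAs ((W.map (algebraMap ℚ K)).IsElliptic)
  have hP : ¬ IsOfFinAddOrder P := by
    intro hfin
    exact hnt ⟨0, by simpa using (AddCommGroup.mem_torsion P).mpr hfin⟩
  exact one_le_mordellWeilRank_of_not_isOfFinAddOrder (W.baseChange K) (W.baseChange K).module_finite_point_holds hP

end Counts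

/-! ## §224 Q ⟹ K -/

/-- **DESC-29-K from DESC-29-Q** (`HeegnerOddDoorPairAtTwo → HeegnerOddDoorFieldSelmerAtTwo`), unconditionally: see the module docstring.
[cite: Kramer1981, Thm. 1, Prop. 6, Prop. 7] [cite: MazurRubin2010, Lemma 3.2] -/
theorem heegnerOddDoorFieldSelmerAtTwo_of_heegnerOddDoorPairAtTwo (hQ : HeegnerOddDoorPairAtTwo) : HeegnerOddDoorFieldSelmerAtTwo := by
  intro W _ _ _ hρ hTam K _ _ hIQ hK Dt H ι P hP hnt
  obtain ⟨hprod, hshaW, hshaT⟩ := hQ W hρ hTam K hIQ hK Dt H ι P hP hnt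
  obtain ⟨h2, hd⟩ := hK
  have hT : NoRationalTwoTorsion W :=
    Summit.BirchSwinnertonDyer.Rank1Residual.F1Sign2.GenusPacket.noRationalTwoTorsion_of_hasSurjectiveModNGaloisRep_two W hρ
  have hΔ : 0 < W.Δ := RankOneAtTwoOneDoor.doorForcesArchimedeanAtTwo_holds W (NumberField.discr K) hd
  have hd0 : NumberField.discr K ≠ 0 := hd.1.ne
  obtain ⟨i, -, hi⟩ := exists_sq_eq_discr_not_mem_range K h2
  have hi' : i ^ 2 = ((NumberField.discr K : ℤ) : K) := by rw [hi, map_intCast]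
  have hθ : i ∉ Set.range (algebraMap ℚ K) := by
    rintro ⟨q, hq⟩
    have hq2 : algebraMap ℚ K (q ^ 2) = algebraMap ℚ K ((NumberField.discr K : ℤ) : ℚ) := by rw [map_pow, hq, hi', map_intCast]
    have hq2' : q ^ 2 = ((NumberField.discr K : ℤ) : ℚ) := (algebraMap ℚ K).injective hq2
    have hd' : ((NumberField.discr K : ℤ) : ℚ) < 0 := by exact_mod_cast hd.1
    nlinarith [sq_nonneg q]
  have hc' : i ^ 2 = algebraMap ℚ K ((NumberField.discr K : ℤ) : ℚ) := by rw [hi', map_intCast]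
  have hSW := selmerTwoCard_eq_two_pow_mul_shaTwoCard W hT
  have hST := twistSelmerTwoCard_eq_two_pow_mul_shaTwoCard W hT hd0
  change shaTwoCard (W.quadraticTwist ((NumberField.discr K : ℤ) : ℚ)) = 1 at hshaT
  rw [hshaW, mul_one] at hSW
  rw [hshaT, mul_one] at hST
  -- the two cases `(#Sel₂ W, #Sel₂ W^d) = (2, 1)` or `(1, 2)`
  have hcases : (selmerTwoCard W = 2 ∧ twistSelmerTwoCard W (NumberField.discr K) = 1) ∨
      (selmerTwoCard W = 1 ∧ twistSelmerTwoCard W (NumberField.discr K) = 2) := by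
    have h1 : selmerTwoCard W ∣ 2 := Dvd.intro _ hprod
    have hle : selmerTwoCard W ≤ 2 := Nat.le_of_dvd two_pos h1
    have hpos : 0 < selmerTwoCard W := Nat.pos_of_ne_zero fun h0 ↦ by rw [h0, zero_mul] at hprod; exact absurd hprod (by norm_num)
    interval_cases (selmerTwoCard W) <;> omega
  rcases hcases with ⟨hS2, hT1⟩ | ⟨hS1, hT2⟩
  · -- `(2, 1)`: rank `W = 1`, DESC-28-G by name
    have hrank : W.mordellWeilRank = 1 := by
      rw [hS2] at hSW
      have h := Nat.pow_right_injective le_rfl (hSW.symm.trans (pow_one 2).symm)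
      exact h
    have hrank0 := mordellWeilRank_quadraticTwist_eq_zero_of_twistSelmerTwoCard_eq_one W hd0 hT1
    have hSel2 : fieldSelmerTwoCard W K = 2 := trivialShaDoorFieldSelmerCardAtTwo_holds W hΔ hT hrank hshaW K ⟨h2, hd⟩ hT1
    refine ⟨hSel2, fieldShaTwoPrimaryCard_eq_one_of_natCard_sha_two_eq_one W K ?_⟩
    have hmul := natCard_selmerGroup_baseChange_two_eq_two_mul W K hT h2 (mordellWeilRank_baseChange_eq_one W K hrank hd.1 hrank0 h2 hi')
    have hF : fieldSelmerTwoCard W K = Nat.card ((W.baseChange K).selmerGroup ((2 : ℕ) : ℤ)) := rfl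
    rw [← hF, hSel2] at hmul
    omega
  · -- `(1, 2)`: `Sel₂(W) = Sel₂^{str ∞}(W)` of order `1`, `#Sel₂^{rel ∞}(W) = 2`, count skeleton
    have hrank0 : W.mordellWeilRank = 0 := by
      rw [hS1] at hSW
      exact Nat.pow_right_injective le_rfl (hSW.symm.trans (pow_zero 2).symm)
    have hrank1 : (W.quadraticTwist ((NumberField.discr K : ℤ) : ℚ)).mordellWeilRank = 1 := by
      rw [hT2] at hST
      exact Nat.pow_right_injective le_rfl (hST.symm.trans (pow_one 2).symm)
    -- `#Sel₂^{str ∞}(W) = 1`, `#Sel₂^{rel ∞}(W) = 2`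
    set w : InfinitePlace ℚ := Rat.infinitePlace with hw
    have hidx := relIndex_kummerStrict_selmerGroupRelaxedAtInfinityAtTwo_eq_two_of_Δ_pos W hΔ w
    have hle : (kummerStrict W 2 {(Sum.inl w : Place ℚ)}).selmerGroup ≤ selmerGroupRelaxedAtInfinityAtTwo W :=
      (selmerGroup_kummerStrict_singleton_inl_le_selmerGroup W _).trans
        (Summit.BirchSwinnertonDyer.Rank1Residual.F1Sign2.selmerGroup_le_selmerGroupRelaxedAtInfinityAtTwo W)
    have hRS : Nat.card ((kummerStrict W 2 {(Sum.inl w : Place ℚ)}).selmerGroup) * 2 =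
        Nat.card (selmerGroupRelaxedAtInfinityAtTwo W) := by
      have h0 := natCard_mul_relIndex_eq_natCard hle
      rwa [hidx] at h0
    have hStr : Nat.card ((kummerStrict W 2 {(Sum.inl w : Place ℚ)}).selmerGroup) = 1 := by
      rcases selmerGroup_eq_kummerStrict_or_eq_relaxed_of_Δ_pos W hΔ w with h | h
      · have e : selmerTwoCard W = Nat.card ((kummerStrict W 2 {(Sum.inl w : Place ℚ)}).selmerGroup) := by
          change Nat.card (W.selmerGroup ((2 : ℕ) : ℤ)) = _
          rw [h]; exact rfl
        rw [← e, hS1]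
      · exfalso
        have e : selmerTwoCard W = Nat.card (selmerGroupRelaxedAtInfinityAtTwo W) := by
          change Nat.card (W.selmerGroup ((2 : ℕ) : ℤ)) = _
          rw [h]
        rw [hS1] at e
        omega
    obtain ⟨r, ⟨a, rfl⟩, hr, hcount⟩ := natCard_selmerGroup_baseChange_two_eq_relaxed_mul W K hT hd h2 hi'
    rw [hStr] at hr
    have ha : a = 0 := by
      rcases a with _ | a
      · rfl
      · exfalso
        have : 2 ≤ 2 ^ (a + 1) := by
          calc (2 : ℕ) = 2 ^ 1 := (pow_one 2).symm
            _ ≤ 2 ^ (a + 1) := Nat.pow_le_pow_right two_pos (by omega)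
        omega
    subst ha
    rw [← hRS, hStr, pow_zero, mul_one, one_mul] at hcount
    have hSel2 : fieldSelmerTwoCard W K = 2 := hcount
    refine ⟨hSel2, fieldShaTwoPrimaryCard_eq_one_of_natCard_sha_two_eq_one W K ?_⟩
    have hrk : (W.baseChange K).mordellWeilRank = 1 := by
      rw [mordellWeilRank_baseChange_eq_add_of_sq_eq W K h2 hθ hc', hrank0, hrank1]
    have hmul := natCard_selmerGroup_baseChange_two_eq_two_mul W K hT h2 hrk
    have hF : fieldSelmerTwoCard W K = Nat.card ((W.baseChange K).selmerGroup ((2 : ℕ) : ℤ)) := rfl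
    rw [← hF, hSel2] at hmul
    omega

/-! ## §225 K ⟹ Q -/

/-- **DESC-29-Q from DESC-29-K** (`HeegnerOddDoorFieldSelmerAtTwo → HeegnerOddDoorPairAtTwo`), unconditionally: see the module docstring.
[cite: Kramer1981, Thm. 1, Prop. 6, Prop. 7] [cite: MazurRubin2010, Lemma 3.2, Prop 3.3] -/
theorem heegnerOddDoorPairAtTwo_of_heegnerOddDoorFieldSelmerAtTwo (hKrow : HeegnerOddDoorFieldSelmerAtTwo) : HeegnerOddDoorPairAtTwo := by
  intro W _ _ _ hρ hTam K _ _ hIQ hK Dt H ι P hP hnt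
  obtain ⟨hSel2, -⟩ := hKrow W hρ hTam K hIQ hK Dt H ι P hP hnt
  obtain ⟨h2, hd⟩ := hK
  have hT : NoRationalTwoTorsion W :=
    Summit.BirchSwinnertonDyer.Rank1Residual.F1Sign2.GenusPacket.noRationalTwoTorsion_of_hasSurjectiveModNGaloisRep_two W hρ
  have hΔ : 0 < W.Δ := RankOneAtTwoOneDoor.doorForcesArchimedeanAtTwo_holds W (NumberField.discr K) hd
  have hd0 : NumberField.discr K ≠ 0 := hd.1.ne
  obtain ⟨i, -, hi⟩ := exists_sq_eq_discr_not_mem_range K h2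
  have hi' : i ^ 2 = ((NumberField.discr K : ℤ) : K) := by rw [hi, map_intCast]
  have hθ : i ∉ Set.range (algebraMap ℚ K) := by
    rintro ⟨q, hq⟩
    have hq2 : algebraMap ℚ K (q ^ 2) = algebraMap ℚ K ((NumberField.discr K : ℤ) : ℚ) := by rw [map_pow, hq, hi', map_intCast]
    have hq2' : q ^ 2 = ((NumberField.discr K : ℤ) : ℚ) := (algebraMap ℚ K).injective hq2
    have hd' : ((NumberField.discr K : ℤ) : ℚ) < 0 := by exact_mod_cast hd.1
    nlinarith [sq_nonneg q]
  have hc' : i ^ 2 = algebraMap ℚ K ((NumberField.discr K : ℤ) : ℚ) := by rw [hi', map_intCast]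
  obtain ⟨χ, hχ⟩ := GenusKolyTransp.quadraticCharacterExists_holds (NumberField.discr K)
  set w : InfinitePlace ℚ := Rat.infinitePlace with hw
  -- `#Sel₂^{rel ∞}(W) = 2`, `#Sel₂^{str ∞}(W) = 1`
  have hidx := relIndex_kummerStrict_selmerGroupRelaxedAtInfinityAtTwo_eq_two_of_Δ_pos W hΔ w
  have hle : (kummerStrict W 2 {(Sum.inl w : Place ℚ)}).selmerGroup ≤ selmerGroupRelaxedAtInfinityAtTwo W :=
    (selmerGroup_kummerStrict_singleton_inl_le_selmerGroup W _).trans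
      (Summit.BirchSwinnertonDyer.Rank1Residual.F1Sign2.selmerGroup_le_selmerGroupRelaxedAtInfinityAtTwo W)
  have hRS : Nat.card ((kummerStrict W 2 {(Sum.inl w : Place ℚ)}).selmerGroup) * 2 =
      Nat.card (selmerGroupRelaxedAtInfinityAtTwo W) := by
    have h0 := natCard_mul_relIndex_eq_natCard hle
    rwa [hidx] at h0
  obtain ⟨r, ⟨a, rfl⟩, -, hcount⟩ := natCard_selmerGroup_baseChange_two_eq_relaxed_mul W K hT hd h2 hi'
  have hF : fieldSelmerTwoCard W K = Nat.card ((W.baseChange K).selmerGroup ((2 : ℕ) : ℤ)) := rfl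
  rw [← hF, hSel2] at hcount
  have hRel : Nat.card (selmerGroupRelaxedAtInfinityAtTwo W) = 2 := by
    have hdvd : Nat.card (selmerGroupRelaxedAtInfinityAtTwo W) ∣ 2 := Dvd.intro _ hcount.symm
    have hle2 := Nat.le_of_dvd two_pos hdvd
    have hpos := Nat.pos_of_dvd_of_pos hdvd two_pos
    omega
  have hStr : Nat.card ((kummerStrict W 2 {(Sum.inl w : Place ℚ)}).selmerGroup) = 1 := by omega
  -- the decided dichotomy: `{#Sel₂ W, #Sel₂ W^{(d)}} = {2, 1}`
  have htw : twistSelmerTwoCard W (NumberField.discr K) = Nat.card (PrimeTwist.selmerGroup W χ) :=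
    (natCard_primeTwist_selmerGroup_eq_twistSelmerTwoCard W hd0 hχ).symm
  have hpair : (selmerTwoCard W = 2 ∧ twistSelmerTwoCard W (NumberField.discr K) = 1) ∨
      (selmerTwoCard W = 1 ∧ twistSelmerTwoCard W (NumberField.discr K) = 2) := by
    rcases primeTwist_selmerGroup_eq_relaxed_or_eq_kummerStrict_decided W hΔ hT hd hχ w with ⟨hall, hPr⟩ | ⟨hex, hPr⟩
    · right
      have hSel : W.selmerGroup ((2 : ℕ) : ℤ) = (kummerStrict W 2 {(Sum.inl w : Place ℚ)}).selmerGroup := by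
        rcases selmerGroup_eq_kummerStrict_or_eq_relaxed_of_Δ_pos W hΔ w with h | h
        · exact h
        · exfalso
          have e : selmerTwoCard W = Nat.card (selmerGroupRelaxedAtInfinityAtTwo W) := by
            change Nat.card (W.selmerGroup ((2 : ℕ) : ℤ)) = _
            rw [h]
          -- then `Sel₂(W) = Sel₂^{rel ∞} ⊋ Sel₂^{str ∞}` has a class non-trivial at `∞`, contradicting `hall`
          have hne : (kummerStrict W 2 {(Sum.inl w : Place ℚ)}).selmerGroup ≠ selmerGroupRelaxedAtInfinityAtTwo W := by
            intro heq
            have h1 : (kummerStrict W 2 {(Sum.inl w : Place ℚ)}).selmerGroup.relIndex (selmerGroupRelaxedAtInfinityAtTwo W) = 1 := by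
              rw [heq, AddSubgroup.relIndex_self]
            rw [h1] at hidx
            exact absurd hidx (by norm_num)
          obtain ⟨c, hcR, hcS⟩ : ∃ c ∈ selmerGroupRelaxedAtInfinityAtTwo W, c ∉ (kummerStrict W 2 {(Sum.inl w : Place ℚ)}).selmerGroup := by
            by_contra hno
            push Not at hno
            exact hne (le_antisymm hle hno)
          exact hcS ((mem_selmerGroup_kummerStrict_singleton_inl_iff W w c).mpr ⟨hcR, hall c (h ▸ hcR)⟩)
      constructor
      · change Nat.card (W.selmerGroup ((2 : ℕ) : ℤ)) = 1
        rw [hSel]; exact hStr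
      · rw [htw, hPr, hRel]
    · left
      have hSel : W.selmerGroup ((2 : ℕ) : ℤ) = selmerGroupRelaxedAtInfinityAtTwo W := by
        rcases selmerGroup_eq_kummerStrict_or_eq_relaxed_of_Δ_pos W hΔ w with h | h
        · exfalso
          obtain ⟨c, hc, hne⟩ := hex
          rw [h] at hc
          exact hne ((mem_selmerGroup_kummerStrict_singleton_inl_iff W w c).mp hc).2
        · exact h
      constructor
      · change Nat.card (W.selmerGroup ((2 : ℕ) : ℤ)) = 2
        rw [hSel]; exact hRel
      · rw [htw, hPr]; exact hStr
  -- ranks: `rank W(K) = 1 = rank W + rank W^{(d)}`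
  haveI : (W.baseChange K).IsElliptic := inferInstanceAs ((W.map (algebraMap ℚ K)).IsElliptic)
  have h1le := one_le_mordellWeilRank_baseChange_of_notTwiceUpToTorsion W K hnt
  have hrk_le : (W.baseChange K).mordellWeilRank ≤ 1 := by
    have h := card_selmerGroup_eq_pow_rank_mul (W.baseChange K) 2
    rw [natCard_torsionBy_two_baseChange_eq_one W K hT h2, mul_one, ← hF, hSel2] at h
    by_contra hgt
    have h4 : 4 ≤ 2 ^ (W.baseChange K).mordellWeilRank :=
      calc (4 : ℕ) = 2 ^ 2 := by norm_num
        _ ≤ _ := Nat.pow_le_pow_right two_pos (by omega)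
    have hpos : 0 < Nat.card ((W.baseChange K).sha ⊓ AddSubgroup.torsionBy (W.baseChange K).galH1 ((2 : ℕ) : ℕ) : AddSubgroup _) :=
      Nat.pos_of_ne_zero fun h0 ↦ by rw [h0, mul_zero] at h; exact absurd h (by norm_num)
    nlinarith
  have hrkK : (W.baseChange K).mordellWeilRank = 1 := le_antisymm hrk_le h1le
  have hsum : W.mordellWeilRank + (W.quadraticTwist ((NumberField.discr K : ℤ) : ℚ)).mordellWeilRank = 1 := by
    rw [← mordellWeilRank_baseChange_eq_add_of_sq_eq W K h2 hθ hc', hrkK]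
  have hSW := selmerTwoCard_eq_two_pow_mul_shaTwoCard W hT
  have hST := twistSelmerTwoCard_eq_two_pow_mul_shaTwoCard W hT hd0
  change _ ∧ _ ∧ shaTwoCard (W.quadraticTwist ((NumberField.discr K : ℤ) : ℚ)) = 1
  rcases hpair with ⟨hS2', hT1⟩ | ⟨hS1, hT2⟩
  · refine ⟨by rw [hS2', hT1], ?_, ?_⟩
    · -- `#Sel₂(W^d) = 1 ⟹ rank W^d = 0 ⟹ rank W = 1 ⟹ Ш(W)[2] = 1`
      rw [hT1] at hST
      obtain ⟨hr0, -⟩ := eq_of_two_pow_mul_eq_one hST.symm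
      have hr1 : W.mordellWeilRank = 1 := by omega
      rw [hS2', hr1, pow_one] at hSW
      omega
    · rw [hT1] at hST
      exact (eq_of_two_pow_mul_eq_one hST.symm).2
  · refine ⟨by rw [hS1, hT2], ?_, ?_⟩
    · rw [hS1] at hSW
      exact (eq_of_two_pow_mul_eq_one hSW.symm).2
    · -- `#Sel₂(W) = 1 ⟹ rank W = 0 ⟹ rank W^d = 1 ⟹ Ш(W^d)[2] = 1`
      rw [hS1] at hSW
      obtain ⟨hr0, -⟩ := eq_of_two_pow_mul_eq_one hSW.symm
      have hr1 : (W.quadraticTwist ((NumberField.discr K : ℤ) : ℚ)).mordellWeilRank = 1 := by omega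
      rw [hT2, hr1, pow_one] at hST
      omega

end Summit.BirchSwinnertonDyer.BirchSwinnertonDyer.Theorems.GenusKolyArch

end
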